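import Summits.ResolutionOfSingularities.ResolutionOfSingularities.Theorems.WeightedInvariantTieFiniteInChart
import HarnessLib

/-!
# Covering primes of a constructible set over a height-two prime; heights; off-chart finiteness
# (door `HypersurfaceCentreConstruction` stmt-ResolutionOfSingularities-19897, route `WeightedInvariant`; (Δ10-a,b,c) of the
# registrar SPEC (Δ10) `TieFreeNearCurve_sketch.lean`, serving clause h7 (c8τ) and the input (T)
# `JOpenLE3.TieFreeAlongCurveLE3 p` of clause h8)

[OURS · L1 W4.3; candidates for the local engine, nothing here is a statement of Hironaka 2017.]

* COVERING CHEVALLEY: res-type-047's `TieFinite.finite_of_isConstructible_subset_zeroLocus` (…TieFiniteInChart) with the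
  hypothesis `hdim : every prime > P is maximal` REMOVED and the conclusion cut to the primes of the constructible set that
  COVER `P` (`P < 𝔮` with no prime strictly between): `finite_covers_basicConstructible_subset_zeroLocus`,
  `finite_covers_of_isConstructible_subset_zeroLocus`, `finite_covers_image_comap_of_isConstructible`.
* HEIGHTS: `eq_of_height_of_lt_of_le` (`2 ≤ ht P`, `ht 𝔮 ≤ 3`, `P < q ≤ 𝔮` ⇒ `q = 𝔮`), `height_le_of_ringKrullDim_le`,
  `height_eq_of_ringKrullDim_eq` (local dimension of `A_𝔮` ↔ height), `exists_not_mem_forall_mem` (a finite set of primes none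
  of which is `≤ 𝔪` has a common element outside `𝔪`), `finite_of_finite_sep_not_mem` (OFF-CHART: the covering primes over
  `P` containing a given `s ∉ P` are minimal primes of `P + (s)`, so «finite on a chart `D(s) ∋ P`» is already «finite»).
* IN-CHART FINITENESS WITHOUT `hmax`: `finite_tiePrimes'` = `TieFinite.finite_tiePrimes` (…TieFiniteInChart) with the hypothesis
  «every prime `> P` is maximal» removed and the index set cut to the primes covering `P` — the form needed at a NON-closed
  model prime (clause h8 input (T)) and, with `eq_of_height_of_lt_of_le`, at all points of a threefold (clause h7 (c8τ)).
-/

noncomputable section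

set_option linter.dupNamespace false

open IsLocalRing Literature.AlgebraicGeometry.Resolution LaurentPolynomial Topology
open Summit.ResolutionOfSingularities.ResolutionOfSingularities.Theorems

namespace Summit.ResolutionOfSingularities.ResolutionOfSingularities.Cruxes.HypersurfaceCentreConstruction.LocalEngine

namespace TieFinite

variable {A : Type} [CommRing A]

/-! ## (Δ10-a) Covering Chevalley: constructible subsets of `V(P)` missing `P` have finitely many points covering `P` -/

/-- **(Δ10-a) basic piece.** A basic constructible set `V(g₁,…,gₙ) ∖ V(f)` inside `V(P)` and missing `P` has finitely many
points `𝔮` COVERING `P` (`P < 𝔮`, no prime strictly between), `A` Noetherian: if all `gᵢ ∈ P` then `f ∈ P` and the set is empty;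
otherwise its points lie over `J = P + (gⱼ) > P` and a covering point containing `J` is a minimal prime of `J`.  (047's
`finite_basicConstructible_subset_zeroLocus` with `hdim` removed.) [folklore] -/
theorem finite_covers_basicConstructible_subset_zeroLocus [IsNoetherianRing A] (P : Ideal A) [hP : P.IsPrime]
    (C : PrimeSpectrum.BasicConstructibleSetData A) (hCZ : C.toSet ⊆ PrimeSpectrum.zeroLocus (P : Set A))
    (hPC : (⟨P, hP⟩ : PrimeSpectrum A) ∉ C.toSet) :
    {𝔮 ∈ C.toSet | ∀ q : Ideal A, q.IsPrime → P < q → q ≤ 𝔮.asIdeal → q = 𝔮.asIdeal}.Finite := by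
  classical
  have hmem : ∀ 𝔮 : PrimeSpectrum A, 𝔮 ∈ C.toSet ↔ (∀ i, C.g i ∈ 𝔮.asIdeal) ∧ C.f ∉ 𝔮.asIdeal := by
    intro 𝔮
    simp only [PrimeSpectrum.BasicConstructibleSetData.toSet, Set.mem_sdiff, PrimeSpectrum.mem_zeroLocus,
      Set.range_subset_iff, SetLike.mem_coe, Set.singleton_subset_iff]
  have hPle : ∀ 𝔮 ∈ C.toSet, P ≤ 𝔮.asIdeal := fun 𝔮 h𝔮 a ha => hCZ h𝔮 ha
  by_cases hg : ∀ i, C.g i ∈ P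
  · have hfP : C.f ∈ P := by
      by_contra hf
      exact hPC ((hmem ⟨P, hP⟩).mpr ⟨hg, hf⟩)
    have hempty : C.toSet = ∅ := by
      ext 𝔮
      simp only [Set.mem_empty_iff_false, iff_false]
      intro h𝔮
      exact ((hmem 𝔮).mp h𝔮).2 (hPle 𝔮 h𝔮 hfP)
    refine Set.Finite.subset (Set.finite_empty) ?_
    intro 𝔮 h𝔮
    rw [hempty] at h𝔮
    exact h𝔮.1
  · push Not at hg
    obtain ⟨j, hj⟩ := hg
    set J : Ideal A := P ⊔ Ideal.span {C.g j} with hJ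
    have hPJ : P < J := by
      refine lt_of_le_of_ne le_sup_left fun h => hj ?_
      rw [h]; exact Ideal.mem_sup_right (Ideal.subset_span rfl)
    have hfinJ : (J.minimalPrimes).Finite := Ideal.finite_minimalPrimes_of_isNoetherianRing A J
    refine Set.Finite.of_injOn (f := fun 𝔮 : PrimeSpectrum A => 𝔮.asIdeal) (fun 𝔮 h𝔮 => ?_)
      (fun a _ b _ h => PrimeSpectrum.ext h) hfinJ
    obtain ⟨h𝔮C, hcov⟩ := h𝔮
    have hJ𝔮 : J ≤ 𝔮.asIdeal :=
      sup_le (hPle 𝔮 h𝔮C) ((Ideal.span_singleton_le_iff_mem 𝔮.asIdeal).mpr (((hmem 𝔮).mp h𝔮C).1 j))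
    refine ⟨⟨𝔮.isPrime, hJ𝔮⟩, fun q hq hq𝔮 => ?_⟩
    exact (hcov q hq.1 (hPJ.trans_le hq.2) hq𝔮).ge

/-- **(Δ10-a) A constructible subset of `V(P)` missing `P` has finitely many points covering `P`** (`A` Noetherian; NO
dimension hypothesis). [folklore] -/
theorem finite_covers_of_isConstructible_subset_zeroLocus [IsNoetherianRing A] (P : Ideal A) [hP : P.IsPrime]
    {Z : Set (PrimeSpectrum A)} (hZ : IsConstructible Z) (hZP : Z ⊆ PrimeSpectrum.zeroLocus (P : Set A))
    (hPZ : (⟨P, hP⟩ : PrimeSpectrum A) ∉ Z) :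
    {𝔮 ∈ Z | ∀ q : Ideal A, q.IsPrime → P < q → q ≤ 𝔮.asIdeal → q = 𝔮.asIdeal}.Finite := by
  classical
  obtain ⟨S, rfl⟩ := PrimeSpectrum.exists_constructibleSetData_iff.mpr hZ
  refine Set.Finite.subset (Set.Finite.biUnion S.finite_toSet fun C hC =>
    finite_covers_basicConstructible_subset_zeroLocus P C (fun 𝔮 h𝔮 => hZP (Set.mem_biUnion hC h𝔮))
      (fun h => hPZ (Set.mem_biUnion hC h))) ?_
  rintro 𝔮 ⟨h𝔮, hcov⟩
  have h𝔮' : ∃ C ∈ S, 𝔮 ∈ C.toSet := by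
    simpa only [PrimeSpectrum.ConstructibleSetData.toSet, Set.mem_iUnion, exists_prop] using h𝔮
  obtain ⟨C, hC, h⟩ := h𝔮'
  exact Set.mem_biUnion hC ⟨h, hcov⟩

/-- **(Δ10-a) Covering Chevalley form.**  For `φ : A → B` of finite presentation and a constructible `W ⊆ Spec B` all of whose
points lie over `V(P)` and none over `P` (`A` Noetherian): the primes of `A` lying under a point of `W` and COVERING `P` are
finitely many. (047's `finite_image_comap_of_isConstructible` with `hdim` removed.) [folklore] -/
theorem finite_covers_image_comap_of_isConstructible [IsNoetherianRing A] {B : Type*} [CommRing B] (φ : A →+* B)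
    (hφ : φ.FinitePresentation) (P : Ideal A) [hP : P.IsPrime]
    {W : Set (PrimeSpectrum B)} (hW : IsConstructible W)
    (hWP : ∀ 𝔫 ∈ W, P ≤ (PrimeSpectrum.comap φ 𝔫).asIdeal)
    (hWη : ∀ 𝔫 ∈ W, (PrimeSpectrum.comap φ 𝔫).asIdeal ≠ P) :
    {𝔮 ∈ PrimeSpectrum.comap φ '' W |
      ∀ q : Ideal A, q.IsPrime → P < q → q ≤ 𝔮.asIdeal → q = 𝔮.asIdeal}.Finite := by
  refine finite_covers_of_isConstructible_subset_zeroLocus P (PrimeSpectrum.isConstructible_comap_image hφ hW) ?_ ?_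
  · rintro _ ⟨𝔫, h𝔫, rfl⟩ a ha
    exact hWP 𝔫 h𝔫 ha
  · rintro ⟨𝔫, h𝔫, h⟩
    exact hWη 𝔫 h𝔫 (congrArg PrimeSpectrum.asIdeal h)

/-! ## (Δ10-b) Height bookkeeping -/

/-- **Covering from heights**: `2 ≤ ht P`, `ht 𝔮 ≤ 3`, `P < q ≤ 𝔮` with `q` prime ⇒ `q = 𝔮`. [cite: Matsumura1987, §5] -/
theorem eq_of_height_of_lt_of_le {P 𝔮 : Ideal A} [P.IsPrime] [𝔮.IsPrime] (hP : 2 ≤ P.height) (h𝔮 : 𝔮.height ≤ 3)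
    (q : Ideal A) (hq : q.IsPrime) (hPq : P < q) (hq𝔮 : q ≤ 𝔮) : q = 𝔮 := by
  by_contra hne
  have hlt : q < 𝔮 := lt_of_le_of_ne hq𝔮 hne
  have h1 : P.height + 1 ≤ q.height := Ideal.height_add_one_le_of_lt_of_isPrime hPq
  have h2 : q.height + 1 ≤ 𝔮.height := Ideal.height_add_one_le_of_lt_of_isPrime hlt
  have h4 : (4 : ℕ∞) ≤ 𝔮.height :=
    calc (4 : ℕ∞) = 2 + 1 + 1 := by norm_num
      _ ≤ P.height + 1 + 1 := add_le_add_left (add_le_add_left hP 1) 1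
      _ ≤ q.height + 1 := add_le_add_left h1 1
      _ ≤ 𝔮.height := h2
  exact absurd (h4.trans h𝔮) (by decide)

/-- `dim A_𝔮 ≤ n ⇒ ht 𝔮 ≤ n`. [folklore] -/
theorem height_le_of_ringKrullDim_le {𝔮 : Ideal A} [𝔮.IsPrime] {n : ℕ}
    (h : ringKrullDim (Localization.AtPrime 𝔮) ≤ n) : 𝔮.height ≤ n := by
  rw [IsLocalization.AtPrime.ringKrullDim_eq_height 𝔮 (Localization.AtPrime 𝔮)] at h
  exact_mod_cast h

/-- `dim A_𝔮 = n ⇒ ht 𝔮 = n`. [folklore] -/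
theorem height_eq_of_ringKrullDim_eq {𝔮 : Ideal A} [𝔮.IsPrime] {n : ℕ}
    (h : ringKrullDim (Localization.AtPrime 𝔮) = n) : 𝔮.height = n := by
  rw [IsLocalization.AtPrime.ringKrullDim_eq_height 𝔮 (Localization.AtPrime 𝔮)] at h
  exact_mod_cast h

/-- **A finite set of primes none of which lies in `𝔪` has a common element outside the prime `𝔪`.** [folklore] -/
theorem exists_not_mem_forall_mem {𝔪 : Ideal A} [h𝔪 : 𝔪.IsPrime] {T : Set (PrimeSpectrum A)} (hT : T.Finite)
    (h : ∀ 𝔮 ∈ T, ¬ 𝔮.asIdeal ≤ 𝔪) : ∃ a ∉ 𝔪, ∀ 𝔮 ∈ T, a ∈ 𝔮.asIdeal := by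
  classical
  induction T, hT using Set.Finite.induction_on with
  | empty => exact ⟨1, fun h1 => h𝔪.ne_top ((Ideal.eq_top_iff_one _).mpr h1), fun _ h => h.elim⟩
  | @insert x s _ _ ih =>
    obtain ⟨a, ha𝔪, ha⟩ := ih fun 𝔮 h𝔮 => h 𝔮 (Set.mem_insert_of_mem _ h𝔮)
    obtain ⟨b, hbx, hb𝔪⟩ := SetLike.not_le_iff_exists.mp (h x (Set.mem_insert _ _))
    refine ⟨a * b, fun hab => (h𝔪.mem_or_mem hab).elim ha𝔪 hb𝔪, fun 𝔮 h𝔮 => ?_⟩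
    rcases Set.mem_insert_iff.mp h𝔮 with rfl | h𝔮
    · exact Ideal.mul_mem_left _ a hbx
    · exact Ideal.mul_mem_right b _ (ha 𝔮 h𝔮)

/-- **OFF-CHART FINITENESS.**  Let `T` be a set of primes over `P`, each covering `P`.  If the members NOT containing a given
`s ∉ P` are finitely many, then `T` is finite: a member containing `s` contains `P + (s) > P` and, covering `P`, is one of the
finitely many minimal primes of `P + (s)` (`A` Noetherian). [folklore] -/
theorem finite_of_finite_sep_not_mem [IsNoetherianRing A] (P : Ideal A) [P.IsPrime] (s : A) (hs : s ∉ P)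
    (T : Set (PrimeSpectrum A)) (hTP : ∀ 𝔮 ∈ T, P ≤ 𝔮.asIdeal)
    (hcov : ∀ 𝔮 ∈ T, ∀ q : Ideal A, q.IsPrime → P < q → q ≤ 𝔮.asIdeal → q = 𝔮.asIdeal)
    (hfin : {𝔮 ∈ T | s ∉ 𝔮.asIdeal}.Finite) : T.Finite := by
  classical
  have hPJ : P < P ⊔ Ideal.span {s} := by
    refine lt_of_le_of_ne le_sup_left fun h => hs ?_
    rw [h]; exact Ideal.mem_sup_right (Ideal.subset_span rfl)
  have hJfin : ((P ⊔ Ideal.span {s}).minimalPrimes).Finite := Ideal.finite_minimalPrimes_of_isNoetherianRing A _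
  have h2 : {𝔮 ∈ T | s ∈ 𝔮.asIdeal}.Finite := by
    refine Set.Finite.of_injOn (f := fun 𝔮 : PrimeSpectrum A => 𝔮.asIdeal) (fun 𝔮 h𝔮 => ?_)
      (fun a _ b _ h => PrimeSpectrum.ext h) hJfin
    obtain ⟨h𝔮T, hs𝔮⟩ := h𝔮
    have hJ𝔮 : P ⊔ Ideal.span {s} ≤ 𝔮.asIdeal :=
      sup_le (hTP 𝔮 h𝔮T) ((Ideal.span_singleton_le_iff_mem 𝔮.asIdeal).mpr hs𝔮)
    refine ⟨⟨𝔮.isPrime, hJ𝔮⟩, fun q hq hq𝔮 => ?_⟩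
    exact (hcov 𝔮 h𝔮T q hq.1 (hPJ.trans_le hq.2) hq𝔮).ge
  refine (hfin.union h2).subset fun 𝔮 h𝔮 => ?_
  by_cases h : s ∈ 𝔮.asIdeal
  · exact Or.inr ⟨h𝔮, h⟩
  · exact Or.inl ⟨h𝔮, h⟩

/-! ## Finitely many COVERING tie primes over the curve, in a chart — `finite_tiePrimes` without `hmax` -/

/-- **FINITELY MANY COVERING TIE PRIMES OVER THE CURVE (in-chart, ring level, NO `hmax`).**  res-type-047's
`TieFinite.finite_tiePrimes` (…TieFiniteInChart) with the hypothesis «every prime strictly above `P` is maximal» REMOVED and the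
index set cut down to the primes COVERING `P` (for primes `𝔮` with `dim A_𝔮 ≤ 3` over `P` of height `2` the covering clause is
automatic, `eq_of_height_of_lt_of_le`).  Proof: the original verbatim, with `finite_covers_image_comap_of_isConstructible` for
`finite_image_comap_of_isConstructible` and the covering clause carried through `hfin.subset`. [cite: AbramovichQuekSchober2025, Thm 1.3 (3), Thm 3.5] -/
theorem finite_tiePrimes' [IsNoetherianRing A] (P : Ideal A) [P.IsPrime] [IsRegularLocalRing (Localization.AtPrime P)]
    (hdimP : ringKrullDim (Localization.AtPrime P) = 2)
    {f : A} {n : ℕ} (hn : 2 ≤ n) (hord : adicOrder (algebraMap A (Localization.AtPrime P) f) = (n : ℕ∞))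
    (U : Fin 2 → A) {r q : ℕ} (hUP : ∀ i, U i ∈ P)
    (hlex : IsLexMaxWeightedCentreGerm (Localization.AtPrime P) (Ideal.span {algebraMap A (Localization.AtPrime P) f})
      (fun i => algebraMap A (Localization.AtPrime P) (U i)) ![r, q] (r * n))
    {G : extReesAlgebra (weightedMonomialIdeal U ![r, q])}
    (hfg : algebraMap A (extReesAlgebra (weightedMonomialIdeal U ![r, q])) f =
      extReesAlgebra.tInv (weightedMonomialIdeal U ![r, q]) ^ (r * n) * G)
    (hG : ¬ extReesAlgebra.tInv (weightedMonomialIdeal U ![r, q]) ∣ G)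
    (hcontr : ∀ m : ℕ, algebraMap A (Localization.AtPrime P) ((G : A[T;T⁻¹]).coeff ((m : ℤ) - 1)) ∈
        weightedMonomialIdeal (fun i => algebraMap A (Localization.AtPrime P) (U i)) ![r, q] m →
      (G : A[T;T⁻¹]).coeff ((m : ℤ) - 1) ∈ weightedMonomialIdeal U ![r, q] m)
    (hF : (algebraMap A (extReesAlgebra (weightedMonomialIdeal U ![r, q]))).FinitePresentation)
    (hWP : ∀ 𝔫 : Ideal (extReesAlgebra (weightedMonomialIdeal U ![r, q])), extReesAlgebra.tInv _ ∈ 𝔫 →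
      Ideal.span (Set.range U) ≤ 𝔫.comap (algebraMap A _))
    (hWc : ∀ (t X G' : extReesAlgebra (weightedMonomialIdeal U ![r, q])) (m : ℕ),
      IsConstructible {𝔫 : PrimeSpectrum (extReesAlgebra (weightedMonomialIdeal U ![r, q])) |
        t ∈ 𝔫.asIdeal ∧ X ∉ 𝔫.asIdeal ∧
          algebraMap _ (Localization.AtPrime 𝔫.asIdeal) G' ∈ maximalIdeal (Localization.AtPrime 𝔫.asIdeal) ^ m})
    (hVU : ∀ 𝔮 : Ideal A, 𝔮.IsPrime → Ideal.span (Set.range U) ≤ 𝔮 → P ≤ 𝔮) :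
    {𝔮 : PrimeSpectrum A | P < 𝔮.asIdeal ∧
      (∀ q' : Ideal A, q'.IsPrime → P < q' → q' ≤ 𝔮.asIdeal → q' = 𝔮.asIdeal) ∧
      ∃ (_ : IsRegularLocalRing (Localization.AtPrime 𝔮.asIdeal))
      (_ : (P.map (algebraMap A (Localization.AtPrime 𝔮.asIdeal))).IsPrime)
      (hu : ∀ i, algebraMap A (Localization.AtPrime 𝔮.asIdeal) (U i) ∈ maximalIdeal (Localization.AtPrime 𝔮.asIdeal)),
      LinearIndependent (ResidueField (Localization.AtPrime 𝔮.asIdeal)) (fun i =>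
        (maximalIdeal (Localization.AtPrime 𝔮.asIdeal)).toCotangent ⟨algebraMap A _ (U i), hu i⟩) ∧
      Iota3.IsTiePosition (Localization.AtPrime 𝔮.asIdeal) (algebraMap A (Localization.AtPrime 𝔮.asIdeal) f) ∧
      algebraMap A (Localization.AtPrime 𝔮.asIdeal) f ∈ maximalIdeal (Localization.AtPrime 𝔮.asIdeal) ^ n ∧
      algebraMap A (Localization.AtPrime 𝔮.asIdeal) f ∉ maximalIdeal (Localization.AtPrime 𝔮.asIdeal) ^ (n + 1) ∧
      ContactCylinder.topStratumPrime Iota3.iotaOrdEps (Localization.AtPrime 𝔮.asIdeal)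
        (algebraMap A (Localization.AtPrime 𝔮.asIdeal) f) = P.map (algebraMap A (Localization.AtPrime 𝔮.asIdeal))}.Finite := by
  classical
  -- p548769 verbatim, `finite_covers_image_comap_of_isConstructible` for `finite_image_comap_of_isConstructible`
  let Wset : Set (PrimeSpectrum (extReesAlgebra (weightedMonomialIdeal U ![r, q]))) := ⋃ i : Fin 2,
    {𝔫 | extReesAlgebra.tInv (weightedMonomialIdeal U ![r, q]) ∈ 𝔫.asIdeal ∧
      LocalGameEFTPointMove.uT U ![r, q] i ∉ 𝔫.asIdeal ∧
        algebraMap _ (Localization.AtPrime 𝔫.asIdeal) G ∈ maximalIdeal (Localization.AtPrime 𝔫.asIdeal) ^ n}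
  have hW : IsConstructible Wset := by
    refine IsConstructible.iUnion fun i => ?_
    exact hWc _ _ G n
  have hpos : ∀ i, 0 < (![r, q] : Fin 2 → ℕ) i := hlex.2.1
  -- covering Chevalley (Δ10-a)
  have hfin := finite_covers_image_comap_of_isConstructible
    (algebraMap A (extReesAlgebra (weightedMonomialIdeal U ![r, q]))) hF P hW ?_ ?_
  rotate_left
  · -- (WP)
    rintro 𝔫 h𝔫
    obtain ⟨i, hT, -, -⟩ := Set.mem_iUnion.mp h𝔫
    exact hVU _ inferInstance (hWP 𝔫.asIdeal hT)
  · -- (Wη)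
    rintro 𝔫 h𝔫 hcomap
    obtain ⟨i, hT, hXi, hmem⟩ := Set.mem_iUnion.mp h𝔫
    have hV : ¬ extReesAlgebra.vertexIdeal (weightedMonomialIdeal U ![r, q]) ≤ 𝔫.asIdeal :=
      fun hle => hXi (hle (uT_mem_vertexIdeal U ![r, q] (hpos i)))
    exact not_mem_pow_of_over_generic P hdimP hn hord U hlex rfl hfg hG hcontr 𝔫 hT hV hcomap hmem
  -- (Wtie): every tie prime is in the image; the covering clause is carried along
  refine hfin.subset ?_
  rintro 𝔮 ⟨hP𝔮, hcov, hreg, hP₀, hu, hli, htie, hfn, hfn', htop⟩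
  haveI := hreg
  haveI := hP₀
  have hcomapP : (P.map (algebraMap A (Localization.AtPrime 𝔮.asIdeal))).comap (algebraMap A _) = P := by
    have h := IsLocalization.under_map_of_isPrime_disjoint 𝔮.asIdeal.primeCompl (Localization.AtPrime 𝔮.asIdeal)
      (I := P) inferInstance (Set.disjoint_left.mpr fun a ha haP => ha (hP𝔮.le haP))
    rwa [Ideal.under_def] at h
  have hlex' := isLexMax_localization_localization 𝔮.asIdeal (P.map (algebraMap A (Localization.AtPrime 𝔮.asIdeal))) P
    hcomapP hlex
  have huP : ∀ i, algebraMap A (Localization.AtPrime 𝔮.asIdeal) (U i) ∈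
      P.map (algebraMap A (Localization.AtPrime 𝔮.asIdeal)) :=
    fun i => Ideal.mem_map_of_mem _ (hUP i)
  obtain ⟨𝔫, hT, hV, hcomap, hmem⟩ := exists_noDrop_prime_of_isTiePosition 𝔮.asIdeal htie hfn hfn'
    (P.map (algebraMap A (Localization.AtPrime 𝔮.asIdeal))) htop U hu hli huP hlex' hfg
  obtain ⟨i, hi⟩ := LocalGameEFTPointMove.exists_uT_not_mem U ![r, q] hV
  refine ⟨⟨𝔫, Set.mem_iUnion.mpr ⟨i, hT, hi, hmem⟩, ?_⟩, hcov⟩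
  exact PrimeSpectrum.ext hcomap

end TieFinite

end Summit.ResolutionOfSingularities.ResolutionOfSingularities.Cruxes.HypersurfaceCentreConstruction.LocalEngine
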